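import Summits.FinalStateConjecture.FinalStateConjecture.Theorems.BartnikGapSettlingGapExhaustionPhotonShellNodeDefs
import Summits.FinalStateConjecture.FinalStateConjecture.Theorems.BartnikGapSettlingGapExhaustionNodeChartPackage
import Summits.FinalStateConjecture.FinalStateConjecture.Theorems.BartnikGapSettlingGapExhaustionLabelWindow
import Summits.FinalStateConjecture.FinalStateConjecture.Theorems.BartnikGapSettlingGapExhaustionIKLocalStepUniform
import Summits.FinalStateConjecture.FinalStateConjecture.Theorems.BartnikGapSettlingGapExhaustionKerrBandHigherRegularityUniform
import Summits.FinalStateConjecture.FinalStateConjecture.Theorems.BartnikGapSettlingGapExhaustionIsMetricOnMetricInCoords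
import Summits.FinalStateConjecture.FinalStateConjecture.Theorems.BartnikGapSettlingGapExhaustionContDiffOnPullbackField
import Summits.FinalStateConjecture.FinalStateConjecture.Theorems.BartnikGapSettlingGapExhaustionKillingCoordBridge
import Summits.FinalStateConjecture.FinalStateConjecture.Theorems.BartnikGapSettlingGapExhaustionKerrCoordKillingSweepSmooth
import Summits.FinalStateConjecture.FinalStateConjecture.Theorems.BartnikGapSettlingGapExhaustionContMDiffOnPushforwardField
import Summits.FinalStateConjecture.FinalStateConjecture.Theorems.BartnikGapSettlingGapExhaustionKillingPushforwardAt
import Summits.FinalStateConjecture.FinalStateConjecture.Theorems.BartnikGapSettlingGapExhaustionRicAtChartKillingLocality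
import Literature.Geometry.Manifold.InjOnLocalDiffeomorphInverse
import Literature.Geometry.Lorentzian.ConnectionNaturality
import Literature.Geometry.Lorentzian.Isometry
import Literature.Geometry.Lorentzian.CausalityOpennessProofs
import Literature.Geometry.Lorentzian.KillingFieldLocalExtension
import HarnessLib

/-!
# Crux `GapExhaustion` (stmt-FinalStateConjecture-10808), line `photon-shell-pseudoconvexity`:
# the OUTWARD SWEEP S5 modulo Ionescu–Klainerman, label-uniform (port of skeleton §3d)

Route `BartnikGapSettling`; helper (`--supports stmt-FinalStateConjecture-10808`) of line lead c13. The theorem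
`outwardSweep_of_IK` of §3d of the crux skeleton `Cruxes/GapExhaustion/Lines/photon_shell_pseudoconvexity.lean`
(rev c13, kernel-checked there as workfile content), moved VERBATIM over the landed node vocabulary
`…PhotonShellNodeDefs.lean` and chart package `…NodeChartPackage.lean`, the skeleton's `def StubOutwardSweep`
inlined as the conclusion and the named fact `Literature.Geometry.Lorentzian.IonescuKlainermanLocalExtension`
(Ionescu–Klainerman, JAMS 26 (2013), Thm 1.2) as the hypothesis: the Hawking Killing field, given on a two-sided
horizon neighbourhood `V` and the uniform collar `belowZone (r₊ + η₄)`, extends as a Killing field out to the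
inner photon-shell face `belowZone (r_ph⁺ − ε)`, with order `6` and ONE tolerance `δ` over the label window
`m₀ ≤ M ≤ m₀⁻¹`, `|a| ≤ χ M`, `r₊ + 2ε ≤ r_ph⁺`. Bricks: `Theorems.isCompact_labelWindowGap`, `stub_ikLocalStepU`,
`stub_kerrBandHigherRegularityU`, `farSilent_band_subset_docOfU/…belowZoneU`, `farSilent_chartPackageU`,
`stub_kerrCoordKillingSweepSmooth`, `stub_isMetricOn_metricInCoords`, `stub_contDiffOn_pullbackField`,
`stub_killingCoord_of_isKillingFieldOn`, `stub_contMDiffOn_pushforwardField`, `stub_killing_pushforward_at`,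
`killingLoc_isKillingFieldOn_congr/…union`. [cite: IonescuKlainerman2013, Thm 1.2] -/

noncomputable section

set_option maxSynthPendingDepth 3

-- D-0017: single-problem summit, `Summit.<S>.<S>.…` by design (cf. lakefile `weak.linter.dupNamespace`).
set_option linter.dupNamespace false

namespace Summit.FinalStateConjecture.FinalStateConjecture.Theorems.PhotonShellNode

open Literature.Geometry.Lorentzian
open Set Filter
open scoped Manifold ContDiff Topology ENNReal

/-- **THE OUTWARD SWEEP S5 FROM IONESCU–KLAINERMAN (label-UNIFORM; modulo the named fact
`IonescuKlainermanLocalExtension`).** Every constant is obtained UNIFORMLY over the compact set of labels of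
the window at which the photon shell leaves the gap `r₊ + 2ε ≤ r_ph⁺` (`Theorems.isCompact_labelWindowGap`), from
the label-uniform bricks `stub_ikLocalStepU` (UN-6), `stub_kerrBandHigherRegularityU` (UN-2),
`farSilent_band_subset_docOfU/…belowZoneU`, `farSilent_chartPackageU`; the mass enters the tolerance only through
`max 1 (m₀⁻¹)⁶`. First a reduction to thin collars `η₄ ≤ ε/2` (`belowZone_mono`), then §1g's sweep through the
cylinders `{r = c}` in the chart, N-5's pushforward and the glue with `K` near the horizon.
[folklore composition; cite: IonescuKlainerman2013, Thm 1.2] -/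
theorem outwardSweep_of_IK : IonescuKlainermanLocalExtension →
    ∀ (χ κ₀ m₀ ε η₄ : ℝ), χ < 1 → 0 < κ₀ → 0 < m₀ → 0 < ε → 0 < η₄ → ∃ (k : ℕ) (δ : ℝ), 0 < δ ∧
    ∀ (𝓢 : Spacetime.{0} 4) [𝓢.metric.HasLeviCivita] (M a : ℝ) (Ψ : (starBG M a).domain → 𝓢.carrier)
      (t : 𝓢.carrier → ℝ), m₀ ≤ M → M ≤ m₀⁻¹ → |a| ≤ χ * M → SilentEternalNearKerr 𝓢 M a Ψ k δ κ₀ t →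
      Kerr.rPlus M a + 2 * ε ≤ rPhPlus M a → ApocentresBelow M a (rPhPlus M a) →
      ∀ (V : Set 𝓢.carrier) (K : Π x : 𝓢.carrier, TangentSpace (𝓡 4) x), HawkingPair 𝓢 M a Ψ K V →
      𝓢.metric.toPseudoRiemannianMetric.IsKillingFieldOn K (V ∪ belowZone 𝓢 M a Ψ (Kerr.rPlus M a + η₄)) →
      ∃ (K' : Π x : 𝓢.carrier, TangentSpace (𝓡 4) x) (V' : Set 𝓢.carrier), HawkingPair 𝓢 M a Ψ K' V' ∧
        𝓢.metric.toPseudoRiemannianMetric.IsKillingFieldOn K' (V' ∪ belowZone 𝓢 M a Ψ (rPhPlus M a - ε)) := by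
  intro hIK
  suffices H : ∀ (χ κ₀ m₀ ε η₄ : ℝ), χ < 1 → 0 < κ₀ → 0 < m₀ → 0 < ε → 0 < η₄ → η₄ ≤ ε / 2 →
      ∃ (k : ℕ) (δ : ℝ), 0 < δ ∧ ∀ (𝓢 : Spacetime.{0} 4) [𝓢.metric.HasLeviCivita] (M a : ℝ)
        (Ψ : (starBG M a).domain → 𝓢.carrier) (t : 𝓢.carrier → ℝ), m₀ ≤ M → M ≤ m₀⁻¹ → |a| ≤ χ * M →
        SilentEternalNearKerr 𝓢 M a Ψ k δ κ₀ t →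
        Kerr.rPlus M a + 2 * ε ≤ rPhPlus M a → ApocentresBelow M a (rPhPlus M a) →
        ∀ (V : Set 𝓢.carrier) (K : Π x : 𝓢.carrier, TangentSpace (𝓡 4) x), HawkingPair 𝓢 M a Ψ K V →
        𝓢.metric.toPseudoRiemannianMetric.IsKillingFieldOn K (V ∪ belowZone 𝓢 M a Ψ (Kerr.rPlus M a + η₄)) →
        ∃ (K' : Π x : 𝓢.carrier, TangentSpace (𝓡 4) x) (V' : Set 𝓢.carrier), HawkingPair 𝓢 M a Ψ K' V' ∧
          𝓢.metric.toPseudoRiemannianMetric.IsKillingFieldOn K' (V' ∪ belowZone 𝓢 M a Ψ (rPhPlus M a - ε)) by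
    intro χ κ₀ m₀ ε η₄ hχ hκ₀ hm₀ hε hη₄
    obtain ⟨k, δ, hδ, H'⟩ := H χ κ₀ m₀ ε (min η₄ (ε / 2)) hχ hκ₀ hm₀ hε (lt_min hη₄ (half_pos hε)) (min_le_right _ _)
    refine ⟨k, δ, hδ, fun 𝓢 _ M a Ψ t hM hM' ha hS hgap hApo V K hKV hKK ↦
      H' 𝓢 M a Ψ t hM hM' ha hS hgap hApo V K hKV (hKK.mono ?_)⟩
    exact union_subset_union_right _ (belowZone_mono 𝓢 M a Ψ _ _ (by linarith [min_le_left η₄ (ε / 2)]))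
  intro χ κ₀ m₀ ε η₄ hχ hκ₀ hm₀ hε hη₄ hηε
  obtain ⟨Kℓ, hKℓ⟩ : ∃ Kℓ : Set (ℝ × ℝ), Kℓ = {ℓ : ℝ × ℝ | m₀ ≤ ℓ.1 ∧ ℓ.1 ≤ m₀⁻¹ ∧
      |ℓ.2| ≤ χ * ℓ.1 ∧ Kerr.rPlus ℓ.1 ℓ.2 + 2 * ε ≤ Kerr.photonOrbitRadius ℓ.1 (-|ℓ.2|)} := ⟨_, rfl⟩
  have hKc : IsCompact Kℓ := by rw [hKℓ]; exact Theorems.isCompact_labelWindowGap χ m₀ ε hm₀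
  have hlab : ∀ ℓ ∈ Kℓ, 0 < ℓ.1 ∧ |ℓ.2| < ℓ.1 := by
    intro ℓ hℓ; rw [hKℓ] at hℓ; obtain ⟨h1, -, h3, -⟩ := hℓ
    have hpos : 0 < ℓ.1 := hm₀.trans_le h1
    have h4 : χ * ℓ.1 < 1 * ℓ.1 := mul_lt_mul_of_pos_right hχ hpos
    exact ⟨hpos, by linarith⟩
  have hgapK : ∀ ℓ ∈ Kℓ, Kerr.rPlus ℓ.1 ℓ.2 + 2 * ε ≤ rPhPlus ℓ.1 ℓ.2 := by
    intro ℓ hℓ; rw [hKℓ] at hℓ; exact hℓ.2.2.2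
  have hrloc : ContinuousOn (fun ℓ : ℝ × ℝ => Kerr.rPlus ℓ.1 ℓ.2 + η₄) Kℓ :=
    (Theorems.continuous_rPlus₂.add continuous_const).continuousOn
  have hrPh : ContinuousOn (fun ℓ : ℝ × ℝ => rPhPlus ℓ.1 ℓ.2) Kℓ := Theorems.continuousOn_rPhPlus₂.mono fun ℓ hℓ ↦ (hlab ℓ hℓ).1
  have hrec : ContinuousOn (fun ℓ : ℝ × ℝ => rPhPlus ℓ.1 ℓ.2 - ε) Kℓ := hrPh.sub continuousOn_const
  have hRfc : ContinuousOn (fun ℓ : ℝ × ℝ => max (3 * ℓ.1) (rPhPlus ℓ.1 ℓ.2 - ε + 2)) Kℓ :=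
    ((continuous_const.mul continuous_fst).continuousOn).sup (hrec.add continuousOn_const)
  have hbandK : ∀ ℓ ∈ Kℓ, Kerr.rPlus ℓ.1 ℓ.2 < Kerr.rPlus ℓ.1 ℓ.2 + η₄ ∧
      Kerr.rPlus ℓ.1 ℓ.2 + η₄ < rPhPlus ℓ.1 ℓ.2 - ε ∧
      rPhPlus ℓ.1 ℓ.2 - ε < Kerr.photonOrbitRadius ℓ.1 (-|ℓ.2|) := by
    intro ℓ hℓ; have hg := hgapK ℓ hℓ
    exact ⟨by linarith, by linarith, show rPhPlus ℓ.1 ℓ.2 - ε < rPhPlus ℓ.1 ℓ.2 by linarith⟩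
  have hη2 : 0 < η₄ / 2 := by positivity
  have hRf1 : ∀ ℓ ∈ Kℓ, Kerr.rPlus ℓ.1 ℓ.2 + η₄ / 2 ≤ max (3 * ℓ.1) (rPhPlus ℓ.1 ℓ.2 - ε + 2) := by
    intro ℓ hℓ; have hg := hgapK ℓ hℓ
    exact (show Kerr.rPlus ℓ.1 ℓ.2 + η₄ / 2 ≤ rPhPlus ℓ.1 ℓ.2 - ε + 2 by linarith).trans (le_max_right _ _)
  have hRf3 : ∀ ℓ ∈ Kℓ, 3 * ℓ.1 ≤ max (3 * ℓ.1) (rPhPlus ℓ.1 ℓ.2 - ε + 2) := fun ℓ _ ↦ le_max_left _ _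
  obtain ⟨δ₆, hδ₆, H6⟩ := Theorems.stub_ikLocalStepU hIK Kℓ (fun ℓ => Kerr.rPlus ℓ.1 ℓ.2 + η₄)
    (fun ℓ => rPhPlus ℓ.1 ℓ.2 - ε) hKc hlab hrloc hrec hbandK
  obtain ⟨ρ₀, L₃, ν, CK, hρ₀, hL₃, -, -, hbandU⟩ :=
    Theorems.stub_kerrBandHigherRegularityU Kℓ (fun ℓ => Kerr.rPlus ℓ.1 ℓ.2 + η₄)
      (fun ℓ => rPhPlus ℓ.1 ℓ.2 - ε) 0 hKc hlab hrloc hrec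
      fun ℓ hℓ ↦ ⟨(hbandK ℓ hℓ).1, (hbandK ℓ hℓ).2.1.le⟩
  obtain ⟨ρ, hρ⟩ : ∃ ρ : ℝ, ρ = min ρ₀ (min η₄ 1 / (4 * (L₃ + 1))) := ⟨_, rfl⟩
  have hL₃1 : 0 < L₃ + 1 := by linarith
  have hρpos : 0 < ρ := by rw [hρ]; exact lt_min hρ₀ (div_pos (lt_min hη₄ one_pos) (by positivity))
  have hρρ₀ : ρ ≤ ρ₀ := by rw [hρ]; exact min_le_left _ _
  have hρL : ρ ≤ min η₄ 1 / (4 * (L₃ + 1)) := by rw [hρ]; exact min_le_right _ _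
  obtain ⟨ρ', hρ', H6'U⟩ := H6 ρ hρpos
  obtain ⟨δd, hδd, HdocU⟩ := farSilent_band_subset_docOfU Kℓ (η₄ / 2)
    (fun ℓ => max (3 * ℓ.1) (rPhPlus ℓ.1 ℓ.2 - ε + 2)) hKc hlab hη2 hRfc hRf1 hRf3
  obtain ⟨δb, hδb, HbzU⟩ := farSilent_band_subset_belowZoneU Kℓ (η₄ / 2)
    (fun ℓ => max (3 * ℓ.1) (rPhPlus ℓ.1 ℓ.2 - ε + 2)) hKc hlab hη2 hRfc hRf1 hRf3
  obtain ⟨δc, hδc, HchartU⟩ := farSilent_chartPackageU Kℓ hKc hlab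
  obtain ⟨CM, hCM⟩ : ∃ CM : ℝ, CM = max 1 (m₀⁻¹ ^ 6) := ⟨_, rfl⟩
  have hCM1 : 1 ≤ CM := by rw [hCM]; exact le_max_left _ _
  have hCMpos : 0 < CM := one_pos.trans_le hCM1
  have hCMwin : ∀ M : ℝ, m₀ ≤ M → ∀ j : ℕ, j ≤ 6 → (M ^ j)⁻¹ ≤ CM := by
    intro M hM j hj
    have hMpos : 0 < M := hm₀.trans_le hM
    rcases le_or_gt 1 M with hM1 | hM1
    · exact (inv_le_one_of_one_le₀ (one_le_pow₀ hM1)).trans hCM1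
    · rw [hCM]; refine le_trans ?_ (le_max_right _ _)
      rw [← inv_pow]
      have h1 : 1 ≤ M⁻¹ := (one_le_inv₀ hMpos).2 hM1.le
      have h2 : M⁻¹ ≤ m₀⁻¹ := (inv_le_inv₀ hMpos hm₀).2 hM
      exact (pow_le_pow_right₀ h1 hj).trans (pow_le_pow_left₀ (inv_nonneg.2 hMpos.le) h2 6)
  obtain ⟨δ, hδ⟩ : ∃ δ : ℝ, δ = min (min δd δb) (min δc (δ₆ / CM)) := ⟨_, rfl⟩
  have hδpos : 0 < δ := by rw [hδ]; exact lt_min (lt_min hδd hδb) (lt_min hδc (div_pos hδ₆ hCMpos))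
  have hδd' : δ ≤ δd := by rw [hδ]; exact (min_le_left _ _).trans (min_le_left _ _)
  have hδb' : δ ≤ δb := by rw [hδ]; exact (min_le_left _ _).trans (min_le_right _ _)
  have hδc' : δ ≤ δc := by rw [hδ]; exact (min_le_right _ _).trans (min_le_left _ _)
  have hδ6' : δ * CM ≤ δ₆ := by
    have h : δ ≤ δ₆ / CM := by rw [hδ]; exact (min_le_right _ _).trans (min_le_right _ _)
    rwa [le_div_iff₀ hCMpos] at h
  refine ⟨6, δ, hδpos, ?_⟩
  intro 𝓢 _ M a Ψ t hM hM' ha hS hgap hApo V K hKV hKK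
  have hMpos : 0 < M := hm₀.trans_le hM
  have ha' : |a| < M := by have h1 : χ * M < 1 * M := mul_lt_mul_of_pos_right hχ hMpos; linarith
  have hrpM : M ≤ Kerr.rPlus M a := le_add_of_nonneg_right (Real.sqrt_nonneg _)
  have hℓK : (M, a) ∈ Kℓ := by rw [hKℓ]; exact ⟨hM, hM', ha, hgap⟩
  obtain ⟨rp, hrp⟩ : ∃ rp : ℝ, rp = Kerr.rPlus M a := ⟨_, rfl⟩
  obtain ⟨c₀, hc₀⟩ : ∃ c₀ : ℝ, c₀ = Kerr.rPlus M a + η₄ := ⟨_, rfl⟩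
  obtain ⟨c₁, hc₁⟩ : ∃ c₁ : ℝ, c₁ = rPhPlus M a - ε := ⟨_, rfl⟩
  have hcase : c₀ < c₁ := by rw [hc₀, hc₁]; linarith
  have hc₀pos : 0 < c₀ := by rw [hc₀]; linarith
  have hc₀gt : Kerr.rPlus M a < c₀ := by rw [hc₀]; linarith
  have hac₀ : |a| ≤ c₀ := by linarith
  have hc₁lt : c₁ < Kerr.photonOrbitRadius M (-|a|) := by rw [hc₁]; show Kerr.photonOrbitRadius M (-|a|) - ε < _; linarith
  obtain ⟨R, hR⟩ : ∃ R : ℝ, R = max (3 * M) (c₁ + 2) := ⟨_, rfl⟩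
  have hR1 : Kerr.rPlus M a + η₄ / 2 ≤ R := by rw [hR]; refine le_trans ?_ (le_max_right _ _); rw [hc₀] at hcase; linarith
  have hR3 : 3 * M ≤ R := by rw [hR]; exact le_max_left _ _
  have hRc₁ : c₁ + 2 ≤ R := by rw [hR]; exact le_max_right _ _
  have H6' := H6'U (M, a) hℓK; have hband := hbandU (M, a) hℓK; have Hdoc := HdocU (M, a) hℓK
  have Hbz := HbzU (M, a) hℓK; have Hchart := HchartU (M, a) hℓK
  dsimp only at H6' hband Hdoc Hbz Hchart
  rw [← hc₀, ← hc₁] at H6' hband; rw [← hc₁, ← hR] at Hdoc Hbz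
  have hCMj : ∀ j : ℕ, j ≤ 6 → (M ^ j)⁻¹ ≤ CM := hCMwin M hM
  have hFS : FarSilentNearKerr 𝓢 M a Ψ 6 δ := hS.1
  have hRF : 𝓢.metric.toPseudoRiemannianMetric.IsRicciFlat := hFS.1
  have hΨe : Topology.IsOpenEmbedding Ψ := hFS.2.2.1
  obtain ⟨Φ, hΦΨ, hdom, hΦs, hΦe, hΦinj, hinjd, hclose⟩ := Hchart 𝓢 Ψ 6 δ hδpos.le hδc' hFS
  have hmem : ∀ z : E4, M < Kerr.radius a z → z ∈ ((starBG M a).domain : Set E4) := by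
    intro z hz; rw [← hdom]; exact hz
  obtain ⟨W, hWdef⟩ : ∃ W : Set E4, W = {z | M < Kerr.radius a z} := ⟨_, rfl⟩
  obtain ⟨D, hDdef⟩ : ∃ D : Set E4,
      D = {y | Kerr.rPlus M a + η₄ / 2 < Kerr.radius a y ∧ Kerr.radius a y < c₁ + 1} := ⟨_, rfl⟩
  have hW : IsOpen W := by rw [hWdef]; exact isOpen_lt continuous_const (Kerr.continuous_radius a)
  have hD : IsOpen D := by
    rw [hDdef]
    exact (isOpen_lt continuous_const (Kerr.continuous_radius a)).inter
      (isOpen_lt (Kerr.continuous_radius a) continuous_const)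
  have hDW : D ⊆ W := by
    intro y hy; rw [hDdef] at hy; rw [hWdef]; show M < Kerr.radius a y; linarith [hy.1]
  have hltc : ∀ c : ℝ, IsOpen {y : E4 | Kerr.radius a y < c} := fun c ↦
    isOpen_lt (Kerr.continuous_radius a) continuous_const
  have hW₀ : IsOpen (D ∩ {y | Kerr.radius a y < c₀}) := hD.inter (hltc c₀)
  have hW₁ : IsOpen (D ∩ {y | Kerr.radius a y < c₁}) := hD.inter (hltc c₁)
  have hΦsW : ContMDiffOn 𝓘(ℝ, E4) (𝓡 4) ∞ Φ W := by rw [hWdef]; exact hΦs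
  have hinjW : ∀ y ∈ W, Function.Injective (mfderiv 𝓘(ℝ, E4) (𝓡 4) Φ y) := by
    intro y hy; rw [hWdef] at hy; exact hinjd y hy
  have hInjW : InjOn Φ W := by rw [hWdef]; exact hΦinj
  have hGmet : MetricCoord.IsMetricOn (𝓢.metricInCoords Φ) W :=
    Theorems.stub_isMetricOn_metricInCoords 𝓢 Φ W hW hΦsW hinjW
  have himg_bz : ∀ y : E4, Kerr.rPlus M a + η₄ / 2 < Kerr.radius a y → Kerr.radius a y < c₀ →
      Φ y ∈ belowZone 𝓢 M a Ψ c₀ := by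
    intro y hy1 hy2
    have hyM : M < Kerr.radius a y := by linarith
    have hc₀R : c₀ ≤ R := by linarith
    have h := Hbz 𝓢 Ψ 6 δ (by norm_num) hδb' hFS c₀ hc₀R
    refine h ⟨⟨y, hmem y hyM⟩, ⟨hy1.le, hy2⟩, ?_⟩
    exact (hΦΨ ⟨y, hmem y hyM⟩).symm
  have himg_doc : ∀ y : E4, Kerr.rPlus M a + η₄ / 2 ≤ Kerr.radius a y → Kerr.radius a y ≤ R →
      Φ y ∈ docOf 𝓢 M a Ψ := by
    intro y hy1 hy2
    have hyM : M < Kerr.radius a y := by linarith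
    have h := Hdoc 𝓢 Ψ 6 δ (by norm_num) hδd' hFS ⟨y, hmem y hyM⟩ hy1 hy2
    rwa [← hΦΨ ⟨y, hmem y hyM⟩] at h
  have hW₀sub : Φ '' (D ∩ {y | Kerr.radius a y < c₀}) ⊆ V ∪ belowZone 𝓢 M a Ψ (Kerr.rPlus M a + η₄) := by
    rintro _ ⟨y, ⟨hyD, hyc⟩, rfl⟩
    rw [hDdef] at hyD
    refine Or.inr ?_
    rw [← hc₀]; exact himg_bz y hyD.1 hyc
  have hKW₀ : 𝓢.metric.toPseudoRiemannianMetric.IsKillingFieldOn K (Φ '' (D ∩ {y | Kerr.radius a y < c₀})) :=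
    hKK.mono hW₀sub
  have hk₀cd : ContDiffOn ℝ ∞ (fun y : E4 => (mfderiv 𝓘(ℝ, E4) (𝓡 4) Φ y).inverse (K (Φ y)))
      (D ∩ {y | Kerr.radius a y < c₀}) :=
    Theorems.stub_contDiffOn_pullbackField 𝓢 Φ _ K hW₀ (hΦsW.mono (inter_subset_left.trans hDW))
      (fun y hy ↦ hinjW y (hDW hy.1)) hKW₀.1
  have hk₀eq := (Theorems.stub_killingCoord_of_isKillingFieldOn 𝓢 Φ _ K hW₀
    (hΦsW.mono (inter_subset_left.trans hDW)) (fun y hy ↦ hinjW y (hDW hy.1)) hKW₀).2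
  have hballs : ∀ c ∈ Icc c₀ c₁, ∀ x : E4, Kerr.radius a x = c → Metric.ball x ρ ⊆ D := by
    intro c hc x hx y hy
    rw [Metric.mem_ball, dist_eq_norm] at hy
    have hw : ‖y - x‖ ≤ ρ₀ := hy.le.trans hρρ₀
    obtain ⟨-, hlip, -⟩ := hband x (hx ▸ hc.1) (hx ▸ hc.2) (y - x) hw
    rw [add_sub_cancel, hx] at hlip
    have h1 : L₃ * ‖y - x‖ ≤ L₃ * (min η₄ 1 / (4 * (L₃ + 1))) :=
      mul_le_mul_of_nonneg_left (hy.le.trans hρL) hL₃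
    have h2 : L₃ * (min η₄ 1 / (4 * (L₃ + 1))) ≤ min η₄ 1 / 4 := by
      rw [mul_div_assoc']
      rw [div_le_div_iff₀ (by positivity) (by norm_num)]
      nlinarith [le_min hη₄.le zero_le_one, min_le_left η₄ 1]
    have h3 := min_le_left η₄ 1
    have h4 := min_le_right η₄ 1
    have h5 := abs_le.1 hlip
    rw [hDdef]
    constructor
    · show Kerr.rPlus M a + η₄ / 2 < Kerr.radius a y
      rw [hc₀] at hc; linarith [hc.1, h5.1]
    · show Kerr.radius a y < c₁ + 1
      linarith [hc.2, h5.2]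
  have hclose6 : ∀ z : E4, (Kerr.rPlus M a + c₀) / 2 ≤ Kerr.radius a z → Kerr.radius a z ≤ c₁ + 1 →
      ∀ j : ℕ, j ≤ 6 → ‖iteratedFDeriv ℝ j (fun z => 𝓢.metricInCoords Φ z - Kerr.bilin M a z) z‖ ≤ δ₆ := by
    intro z hz _ j hj
    have hzM : M < Kerr.radius a z := by rw [hc₀] at hz; linarith
    have hr : 0 < Kerr.radius a z := hMpos.trans hzM
    refine (hclose z hzM j hj).trans ?_
    calc δ * M / Kerr.radius a z ^ (j + 1) ≤ δ * M / M ^ (j + 1) := by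
          apply div_le_div_of_nonneg_left (by positivity) (by positivity)
          exact pow_le_pow_left₀ hMpos.le hzM.le _
      _ = δ * (M ^ j)⁻¹ := by field_simp; ring
      _ ≤ δ * CM := mul_le_mul_of_nonneg_left (hCMj j hj) hδpos.le
      _ ≤ δ₆ := hδ6'
  have hloc := H6' 𝓢 Φ hRF hΦs hΦe hinjd hclose6
  obtain ⟨kf, hkfcd, hkfeq, hkfagree⟩ := Theorems.stub_kerrCoordKillingSweepSmooth (𝓢.metricInCoords Φ) W D a
    c₀ c₁ ρ ρ' (fun y : E4 => (mfderiv 𝓘(ℝ, E4) (𝓡 4) Φ y).inverse (K (Φ y))) hGmet hD hDW hcase.le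
    hc₀pos hac₀ hρ' hρpos hballs hloc hk₀cd hk₀eq
  have hW₁W : D ∩ {y | Kerr.radius a y < c₁} ⊆ W := inter_subset_left.trans hDW
  have hinjW₁ : InjOn Φ (D ∩ {y | Kerr.radius a y < c₁}) := hInjW.mono hW₁W
  obtain ⟨Kp, hKp⟩ : ∃ Kp : Π p : 𝓢.carrier, TangentSpace (𝓡 4) p, Kp = fun p : 𝓢.carrier ↦
      (mfderiv 𝓘(ℝ, E4) (𝓡 4) Φ (Function.invFunOn Φ (D ∩ {y | Kerr.radius a y < c₁}) p)
        (kf (Function.invFunOn Φ (D ∩ {y | Kerr.radius a y < c₁}) p)) : TangentSpace (𝓡 4) p) := ⟨_, rfl⟩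
  have hKpsm := Theorems.stub_contMDiffOn_pushforwardField 𝓢 Φ _ kf hW₁ (hΦsW.mono hW₁W)
    (fun y hy ↦ hinjW y (hW₁W hy)) hinjW₁ hkfcd
  have hKpKil : 𝓢.metric.toPseudoRiemannianMetric.IsKillingFieldOn Kp (Φ '' (D ∩ {y | Kerr.radius a y < c₁})) := by
    rw [hKp]
    refine ⟨hKpsm, ?_⟩
    rintro _ ⟨y, hy, rfl⟩ Y Z
    have hkd : DifferentiableAt ℝ kf y :=
      ((hkfcd y hy).contDiffAt (hW₁.mem_nhds hy)).differentiableAt (by simp)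
    exact Theorems.stub_killing_pushforward_at 𝓢 Φ _ kf hW₁ (hΦsW.mono hW₁W)
      (fun y hy ↦ hinjW y (hW₁W hy)) hinjW₁ hKpsm y hy hkd (hkfeq y hy) Y Z
  have hKpK : ∀ y ∈ D ∩ {y | Kerr.radius a y < c₀}, Kp (Φ y) = K (Φ y) := by
    intro y hy
    have hy1 : y ∈ D ∩ {y | Kerr.radius a y < c₁} := ⟨hy.1, lt_trans (show Kerr.radius a y < c₀ from hy.2) hcase⟩
    have hinv : (mfderiv 𝓘(ℝ, E4) (𝓡 4) Φ y).IsInvertible :=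
      PseudoRiemannianMetric.isInvertible_mfderiv_of_injective (Φ := Φ) rfl (hinjW y (hDW hy.1))
    rw [hKp]
    show mfderiv 𝓘(ℝ, E4) (𝓡 4) Φ (Function.invFunOn Φ (D ∩ {y | Kerr.radius a y < c₁}) (Φ y))
        (kf (Function.invFunOn Φ (D ∩ {y | Kerr.radius a y < c₁}) (Φ y))) = K (Φ y)
    rw [Literature.Geometry.Manifold.invFunOn_apply hinjW₁ hy1, hkfagree hy]
    exact hinv.self_apply_inverse _
  have hW₁W₀ : ∀ y ∈ W, (Kerr.radius a y < Kerr.rPlus M a + 3 * η₄ / 4 ∨ c₁ + 1 / 2 < Kerr.radius a y) →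
      Φ y ∈ Φ '' (D ∩ {y | Kerr.radius a y < c₁}) → y ∈ D ∩ {y | Kerr.radius a y < c₀} := by
    rintro y hyW hyr ⟨y₁, hy₁, hyy⟩
    have heq : y₁ = y := hInjW (hW₁W hy₁) hyW hyy
    subst heq
    rcases hyr with h | h
    · exact ⟨hy₁.1, show Kerr.radius a y₁ < c₀ by rw [hc₀]; linarith⟩
    · exact absurd hy₁.2 (by show ¬ (Kerr.radius a y₁ < c₁); linarith)
  classical
  obtain ⟨K', hK'⟩ : ∃ K' : Π p : 𝓢.carrier, TangentSpace (𝓡 4) p, K' = fun p : 𝓢.carrier ↦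
      if p ∈ Φ '' (D ∩ {y | Kerr.radius a y < c₁}) then Kp p else K p := ⟨_, rfl⟩
  obtain ⟨U', hU'⟩ : ∃ U' : Set E4, U' = {y | M < Kerr.radius a y ∧
      (Kerr.radius a y < Kerr.rPlus M a + 3 * η₄ / 4 ∨ c₁ + 1 / 2 < Kerr.radius a y)} := ⟨_, rfl⟩
  have hU'W : U' ⊆ W := by intro y hy; rw [hU'] at hy; rw [hWdef]; exact hy.1
  have hU'open : IsOpen U' := by
    rw [hU']
    exact (isOpen_lt continuous_const (Kerr.continuous_radius a)).inter
      ((isOpen_lt (Kerr.continuous_radius a) continuous_const).union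
        (isOpen_lt continuous_const (Kerr.continuous_radius a)))
  have hK'K_of : ∀ p : 𝓢.carrier, (p ∈ Φ '' (D ∩ {y | Kerr.radius a y < c₁}) →
      ∃ y ∈ D ∩ {y | Kerr.radius a y < c₀}, Φ y = p) → K' p = K p := by
    intro p hp
    rw [hK']
    by_cases h : p ∈ Φ '' (D ∩ {y | Kerr.radius a y < c₁})
    · obtain ⟨y, hy, rfl⟩ := hp h
      simp only [h, if_true]
      exact hKpK y hy
    · simp only [h, if_false]
  have hK'U' : ∀ y ∈ U', K' (Φ y) = K (Φ y) := by
    intro y hy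
    refine hK'K_of _ fun h ↦ ⟨y, hW₁W₀ y (hU'W hy) (by rw [hU'] at hy; exact hy.2) h, rfl⟩
  have hbij : ∀ U : Set E4, U ⊆ W → IsOpen U → IsOpen (Φ '' U) := fun U hUW hU ↦
    Literature.Geometry.Manifold.isOpen_image_of_bijective_mfderiv hU (hΦsW.mono hUW) fun z hz ↦
      mfderiv_bijective_of_injective (hinjW z (hUW hz)) rfl
  have hdocOpen : IsOpen (docOf 𝓢 M a Ψ) :=
    𝓢.metric.isOpen_chronologicalPast_of_boundaryless 𝓢.timeOrientation _
  have hbzOpen : ∀ ρ₁ : ℝ, IsOpen (belowZone 𝓢 M a Ψ ρ₁) := by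
    intro ρ₁
    refine IsOpen.inter ?_ hdocOpen
    exact hΨe.isOpenMap _ ((hltc ρ₁).preimage continuous_subtype_val)
  have hV'open : IsOpen (V ∩ Φ '' U') := hKV.1.inter (hbij U' hU'W hU'open)
  have hhor : horizonOf 𝓢 M a Ψ ⊆ V ∩ Φ '' U' := by
    intro p hp
    refine ⟨hKV.2.1 hp, ?_⟩
    obtain ⟨hpf, ⟨x, rfl⟩⟩ := hp
    have hxM : M < Kerr.radius a x.1 := by
      have hx := x.2
      have : (x.1 : E4) ∈ ((starBG M a).domain : Set E4) := hx
      rw [← hdom] at this; exact this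
    refine ⟨x.1, ?_, hΦΨ x⟩
    rw [hU']
    refine ⟨hxM, ?_⟩
    by_contra hnot
    rw [not_or, not_lt, not_lt] at hnot
    have hdoc : Φ x.1 ∈ docOf 𝓢 M a Ψ := himg_doc x.1 (by linarith [hnot.1]) (by linarith [hnot.2])
    rw [hΦΨ x] at hdoc
    have hem := hdocOpen.inter_frontier_eq
    have : Ψ x ∈ docOf 𝓢 M a Ψ ∩ frontier (docOf 𝓢 M a Ψ) := ⟨hdoc, hpf⟩
    rw [hem] at this
    exact this
  have hK'V' : ∀ p ∈ V ∩ Φ '' U', K' p = K p := by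
    rintro _ ⟨-, ⟨y, hy, rfl⟩⟩
    exact hK'U' y hy
  have hHP : HawkingPair 𝓢 M a Ψ K' (V ∩ Φ '' U') := by
    refine ⟨hV'open, hhor, ?_, fun p hp ↦ ?_⟩
    · exact Theorems.killingLoc_isKillingFieldOn_congr 𝓢 _ K K' hV'open hK'V'
        (hKV.2.2.1.mono inter_subset_left)
    · rw [hK'V' p (hhor hp)]
      exact hKV.2.2.2 p hp
  obtain ⟨U'', hU''⟩ : ∃ U'' : Set E4, U'' = {y | M < Kerr.radius a y ∧
      Kerr.radius a y < Kerr.rPlus M a + 3 * η₄ / 4} := ⟨_, rfl⟩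
  have hU''U' : U'' ⊆ U' := by intro y hy; rw [hU''] at hy; rw [hU']; exact ⟨hy.1, Or.inl hy.2⟩
  have hO₁ : 𝓢.metric.toPseudoRiemannianMetric.IsKillingFieldOn K' (Φ '' (D ∩ {y | Kerr.radius a y < c₁})) := by
    refine Theorems.killingLoc_isKillingFieldOn_congr 𝓢 _ Kp K' (hbij _ hW₁W hW₁) (fun p hp ↦ ?_) hKpKil
    rw [hK']
    simp only [hp, if_true]
  have hO₂open : IsOpen ((V ∩ Φ '' U') ∪ (belowZone 𝓢 M a Ψ c₀ ∩ Φ '' U'')) :=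
    hV'open.union ((hbzOpen c₀).inter (hbij U'' (hU''U'.trans hU'W) (by
      rw [hU'']
      exact (isOpen_lt continuous_const (Kerr.continuous_radius a)).inter
        (isOpen_lt (Kerr.continuous_radius a) continuous_const))))
  have hO₂ : 𝓢.metric.toPseudoRiemannianMetric.IsKillingFieldOn K'
      ((V ∩ Φ '' U') ∪ (belowZone 𝓢 M a Ψ c₀ ∩ Φ '' U'')) := by
    refine Theorems.killingLoc_isKillingFieldOn_congr 𝓢 _ K K' hO₂open (fun p hp ↦ ?_) (hKK.mono ?_)
    · rcases hp with hp | ⟨-, ⟨y, hy, rfl⟩⟩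
      · exact hK'V' p hp
      · exact hK'U' y (hU''U' hy)
    · refine union_subset_union inter_subset_left ?_
      rw [← hc₀]; exact inter_subset_left
  have hunion := Theorems.killingLoc_isKillingFieldOn_union 𝓢 _ _ K' (hbij _ hW₁W hW₁) hO₂open hO₁ hO₂
  refine ⟨K', V ∩ Φ '' U', hHP, hunion.mono ?_⟩
  rintro p (hp | hp)
  · exact Or.inr (Or.inl hp)
  · rw [← hc₁] at hp
    obtain ⟨⟨x, hxc, rfl⟩, hpdoc⟩ := hp
    have hxM : M < Kerr.radius a x.1 := by
      have : (x.1 : E4) ∈ ((starBG M a).domain : Set E4) := x.2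
      rw [← hdom] at this; exact this
    by_cases hxr : Kerr.rPlus M a + η₄ / 2 < Kerr.radius a x.1
    · refine Or.inl ⟨x.1, ⟨?_, hxc⟩, hΦΨ x⟩
      rw [hDdef]; exact ⟨hxr, by linarith [show Kerr.radius a x.1 < c₁ from hxc]⟩
    · refine Or.inr (Or.inr ⟨⟨⟨x, ?_, rfl⟩, hpdoc⟩, ⟨x.1, ?_, hΦΨ x⟩⟩)
      · show Kerr.radius a x.1 < c₀
        rw [hc₀]; linarith
      · rw [hU'']; exact ⟨hxM, by linarith⟩

end Summit.FinalStateConjecture.FinalStateConjecture.Theorems.PhotonShellNode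

end
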